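import Literature.MathematicalPhysics.QuantumFieldTheory.Balaban1983to89.B6SectCOperators
import Literature.MathematicalPhysics.QuantumFieldTheory.Balaban1983to89.B6SectAVectorModelV1

/-!
# `Balaban1983to89.B6SectCTwoScaleV1` — T. Bałaban, *Propagators and renormalization transformations for lattice gauge
# theories. II*, Commun. Math. Phys. **96** (1984) 223–250 [Balaban1984PropagatorsII], Sect. C pp. 239–246 ON THE V1
# MULTI-LEVEL TORUS CALCULUS, part 1: the CONCRETE two-scale setting of the representation (2.129) — the nested family
# `Ω_i = T (i ≤ j)`, `Ω_{j+1}^{(j+1)} = Λ′` of (2.1)–(2.3) (*"only two scales are present now"*), its sets `Λ^c`, `Λ′` of sites and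
# bonds and its `N(Q′)`; the operators `Q′_j`, `Q_j`, `∂₁`, the admissible `ω` of (2.104), the block axial gauge `Π_{y∈Λ′}δ_{Ax(y)}`,
# `Q″` with `Q = Q″Q_j` (2.119) and the weight `a`, on the `ℓ²` carriers

statement-level skeleton of published theorems with citation tags; proofs where landed; nothing here is a claim about the Yang–Mills mass gap

PDF held: `paper:balaban1984-cmp96-propagators-rt-ii` (journal page = PDF page + 222); pp. 239–246 read AS IMAGES on the ×2
renders `run/shared/lean/pub/pub-balaban/b2b-balaban-ref1/pages/1984-cmp96-propagators-rt-II/…-p017…p024-x2.png` (2026-08-21).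
CITATION HEADER (lean-in-tree rule).  WHAT IS REPRODUCED: lit-balaban SKELETON rows **B6.Eq2.129 / B6.Eq2.119** (with B6.Eq2.96,
2.101, 2.103, 2.104): the data over which `…B6SectCOperators.TwoScaleData` (same seat) DEFINES every operator of (2.129), made
CONCRETE on the carriers OF RECORD of the series (`Site P j`, `PBond P j` of `…Setup`, the linear calculus `LatticeFieldCalculus`
(r18), the multi-domain model `…B6SectADomainsV1`/`…B6SectAOperatorsV1`/`…B6SectAOntoV1` (p21)); part 2 `…B6SectCTwoScaleV1Lattice`
(same seat) constructs `H′_j` (2.101), assembles the data `tsV1` and PROVES `IsLattice`/`Positive`; the sequel `…B6Eq2129TwoScaleV1`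
applies `…B6Repr2129Positivity.eq2129_of_pos`.  PHASE-2 seat p22 (gen 8); owner r03, referee ref-4.  IMPORTS BY NAME, restating
nothing: p21's `Domains` (the two-scale setting IS a nested family with `k = j + 1`), `onE`/`ScalarSpace`, `siteAvgIterLin`/
`bondAvgIterLin`; r18's `grad`, `siteAvg`, `bondAvg`, `stairSum`; p08's `pull` (block-constant lift); p09's `BondSpace`.

PRINT (verbatim).  p. 239: *"On this torus we define operators R, Δ_a as in (2.17), (2.19), but only two scales are present now
… and we take Q′*aQ′, Q*aQ equal to Q′*_{j+1}a_{j+1}Q′_{j+1}, Q*_{j+1}aQ_{j+1} on B^j(Λ), and to Q′_j*a_jQ′_j, Q_j*aQ_j on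
T_□∖B^j(Λ)"*; p. 240 (2.97): *"exp[−½a Σ_{b∈Λ^c}|(Q_jA)(b)|² − ½aL^{d−2} Σ_{c∈Λ′}|(Q_{j+1}A)(c)|² − …] · Π_{y∈Λ′}δ_{Ax(y)}(Q_jA + ∂₁ω)
…"*, *"The configurations ω, ω′ are defined on Λ"*; p. 241: *"(Q_jA^λ)(b) = (Q_jA)(b) − (∂₁μ)(b), (Q_{j+1}A^λ)(c) = (Q_{j+1}A)(c) −
(∂^LQ′₁μ)(c), (2.103) … Hence these terms are invariant if and only if ∂₁μ = 0 on Λ^c and ∂^LQ′₁μ = 0 on Λ′ … μ = 0 on Λ^c, Q′₁μ = 0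
on Λ′. (2.104) This matches our needs exactly because the unit lattice gauge functions ω appearing in the integral (2.97) satisfy
the above conditions … Q′λ₀ = Q′_jλ₀ = ω = 0 on Λ^c, and Q′λ₀ = Q′_{j+1}λ₀ = Q′₁ω = 0 on Λ′"*.

CONTENTS (definition lane; 0 sorry; standard axioms; `j + 1 ≤ m + K` the standing range, `Λ′` any finite set of sites of
`T^{(j+1)}`).  §1 `twoScale j hj Λ′ : Domains P` and its dictionary: `Om_of_le`, `Om_succ`, `lamSite_j` (`Λ_j` sites `= Λ^c`: block
not in `Λ′`), `lamSite_succ` (`Λ_{j+1} = Λ′`), `lamBond_j` (`Λ_j` bonds = both end-points in `Λ^c` — p21's reading of (2.3), under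
which (2.103)–(2.104) give the invariance), `lamBond_succ` (an end-point in `Λ′`), no other level, **`inGauge_iff`** (`λ ∈ N(Q′)` ⟺
*"Q′_jλ = 0 on Λ^c, Q′₁Q′_jλ = 0 on Λ′"*), `constr_zero_iff`.  §2 the carriers `USite`/`UBond` (`ℓ²` of the unit lattice `T^{(j)}`),
`CIdx = OutBond ⊕ InBond` (`𝔅 = Λ^c ∪ Λ′`), `CSpace`; the operators `Qp = Q′_j` (`siteAvgIter j`), `Qv = Q_j` (`bondAvgIter j`), `d1 =
∂₁` (factor `c′`), `pullE` (block-constant lift, `Qp_pullE`: a right inverse of `Q′_j`), the admissible `ω` (`admissible`: `ω = 0`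
off `B(Λ′)`, `Q′₁ω = 0` on `Λ′`; `siteAvg_admissible`: then `Q′₁ω ≡ 0`), the axial `B` (`axial`, staircase sums on the blocks of
`Λ′`), `Q″` (`Qpp`: restriction to the `Λ^c`-bonds, `Q₁` on the `Λ′`-bonds), the weight `aW w` and the printed weights `wPrinted a`
(`a`, `aL^{d−2}`).  HONEST SCOPE: ℓ² pairings without volume factors and centred blocks (as in p21's model, DIVERGENCE F2/F3 of
`pub-balaban`); the fine lattice is `T^{(0)}` and the *"unit lattice"* is `T^{(j)}` (the paper rescales to `ξ = L^{−j}`,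
immaterial); `Λ′` is not required to be a union of big blocks nor non-empty (the algebra does not use it); NOT summit progress.
Unit `lit-balaban-p22` (gen 8), HOME `run/shared/lean/pub/lit-balaban/`, 2026-08-21.
-/

noncomputable section

open scoped InnerProductSpace

namespace Literature.MathematicalPhysics.QuantumFieldTheory.Balaban1983to89.B6SectCTwoScaleV1

open LatticeFieldCalculus B6SectADomainsV1 B6SectAZeroModesV1 B6SectAOntoV1 B6SectAOperatorsV1 B6SectCOperators
open BalabanImbrieJaffe1984to88.BIJ85AxialPropagator411 (BondSpace PlaqSpace stairSum_add stairSum_smul bondAvg_add bondAvg_smul)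
open BalabanImbrieJaffe1984to88.BIJ85GaugeFunction5113 (pull pull_apply siteAvgIter_pull grad_add grad_smul siteAvg_add
  siteAvg_smul)

variable {P : Params}

/-! ## §1  The two-scale nested family of Sect. C as a `Domains` (2.1)–(2.3) -/

/-- **The two scales of Sect. C** (p. 239 *"only two scales are present now"*): `Ω_i^{(i)} = T^{(i)}` for `i ≤ j`,
`Ω_{j+1}^{(j+1)} = Λ′`, `k = j + 1` — so `Λ_i = ∅` for `i < j`, `Λ_j = Λ^c = T^{(j)} ∖ B(Λ′)` (with `Q_j`-constraints) and
`Λ_{j+1} = Λ′` (with `Q_{j+1}`-constraints), as in (2.97). [cite: Balaban1984PropagatorsII, (2.89) p.239 + (2.97) p.240] -/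
def twoScale (j : ℕ) (hj : j + 1 ≤ P.m + P.K) (Λ' : Finset (Site P (j + 1))) : Domains P where
  k := j + 1
  hk := hj
  Om i := if i ≤ j then Finset.univ else if h : i = j + 1 then Finset.univ.filter (fun y => h ▸ y ∈ Λ') else ∅
  Om_zero := by simp
  Om_eq_empty i hi := by
    have h1 : ¬ i ≤ j := by omega
    have h2 : ¬ i = j + 1 := by omega
    simp [h1, h2]
  nested i y hy := by
    by_cases hi : i ≤ j
    · simp [hi]
    · exfalso
      have h1 : ¬ i + 1 ≤ j := by omega
      have h2 : ¬ i = j := by omega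
      simp [h1, h2] at hy

namespace twoScale

variable {j : ℕ} {hj : j + 1 ≤ P.m + P.K} {Λ' : Finset (Site P (j + 1))}

/-- `Ω_i^{(i)} = T^{(i)}` for `i ≤ j`. [cite: Balaban1984PropagatorsII, (2.89) p.239] -/
theorem Om_of_le {i : ℕ} (hi : i ≤ j) : (twoScale j hj Λ').Om i = Finset.univ := by
  simp [twoScale, hi]

/-- `Ω_{j+1}^{(j+1)} = Λ′`. [cite: Balaban1984PropagatorsII, (2.89) p.239] -/
theorem Om_succ : (twoScale j hj Λ').Om (j + 1) = Λ' := by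
  show (if j + 1 ≤ j then Finset.univ else
    if h : j + 1 = j + 1 then Finset.univ.filter (fun y => h ▸ y ∈ Λ') else ∅) = Λ'
  rw [if_neg (by omega), dif_pos rfl]
  exact Finset.filter_univ_mem Λ'

/-- `k = j + 1`. [cite: Balaban1984PropagatorsII, (2.89) p.239] -/
theorem k_eq : (twoScale j hj Λ').k = j + 1 := rfl

/-- `Λ_j` (sites) `= Λ^c`: the `j`-sites whose block is not in `Λ′`. [cite: Balaban1984PropagatorsII, (2.97) p.240] -/
theorem lamSite_j (y : Site P j) : (twoScale j hj Λ').LamSite j y ↔ blockOf y ∉ Λ' := by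
  simp [Domains.LamSite, Domains.Deep, Om_of_le le_rfl, Om_succ]

/-- `Λ_{j+1}` (sites) `= Λ′`. [cite: Balaban1984PropagatorsII, (2.97) p.240] -/
theorem lamSite_succ (Y : Site P (j + 1)) : (twoScale j hj Λ').LamSite (j + 1) Y ↔ Y ∈ Λ' := by
  have h : (twoScale j hj Λ').Om (j + 1 + 1) = ∅ := (twoScale j hj Λ').Om_eq_empty (by show j + 1 < j + 1 + 1; omega)
  simp [Domains.LamSite, Domains.Deep, Om_succ, h]

/-- no sites of level `i < j`. [cite: Balaban1984PropagatorsII, (2.97) p.240] -/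
theorem not_lamSite_of_lt {i : ℕ} (hi : i < j) (y : Site P i) : ¬ (twoScale j hj Λ').LamSite i y := by
  simp [Domains.LamSite, Domains.Deep, Om_of_le hi.le, Om_of_le (Nat.succ_le_of_lt hi)]

/-- no sites of level `i > j + 1`. [cite: Balaban1984PropagatorsII, (2.97) p.240] -/
theorem not_lamSite_of_gt {i : ℕ} (hi : j + 1 < i) (y : Site P i) : ¬ (twoScale j hj Λ').LamSite i y :=
  (twoScale j hj Λ').not_lamSite_of_lt (show j + 1 < i from hi) y

/-- `Λ_j` (bonds) = the `j`-bonds with both end-points in `Λ^c` (the `b ∈ Λ^c` of (2.97)). [cite: Balaban1984PropagatorsII, (2.97) p.240] -/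
theorem lamBond_j (b : PBond P j) :
    (twoScale j hj Λ').LamBond j b ↔ blockOf b.src ∉ Λ' ∧ blockOf b.tgt ∉ Λ' := by
  simp [Domains.LamBond, Domains.Deep, Om_of_le le_rfl, Om_succ]

/-- `Λ_{j+1}` (bonds) = the `(j+1)`-bonds with an end-point in `Λ′` (the `c ∈ Λ′` of (2.97)). [cite: Balaban1984PropagatorsII, (2.97) p.240] -/
theorem lamBond_succ (e : PBond P (j + 1)) : (twoScale j hj Λ').LamBond (j + 1) e ↔ e.src ∈ Λ' ∨ e.tgt ∈ Λ' := by
  have h : (twoScale j hj Λ').Om (j + 1 + 1) = ∅ := (twoScale j hj Λ').Om_eq_empty (by show j + 1 < j + 1 + 1; omega)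
  simp [Domains.LamBond, Domains.Deep, Om_succ, h]

/-- no bonds of level `i < j`. [cite: Balaban1984PropagatorsII, (2.97) p.240] -/
theorem not_lamBond_of_lt {i : ℕ} (hi : i < j) (b : PBond P i) : ¬ (twoScale j hj Λ').LamBond i b := by
  simp [Domains.LamBond, Domains.Deep, Om_of_le hi.le, Om_of_le (Nat.succ_le_of_lt hi)]

/-- no bonds of level `i > j + 1`. [cite: Balaban1984PropagatorsII, (2.97) p.240] -/
theorem not_lamBond_of_gt {i : ℕ} (hi : j + 1 < i) (b : PBond P i) : ¬ (twoScale j hj Λ').LamBond i b :=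
  (twoScale j hj Λ').not_lamBond_of_lt (show j + 1 < i from hi) b

/-- **`N(Q′)` of the two-scale setting** (p. 241: *"Q′λ₀ = Q′_jλ₀ = ω = 0 on Λ^c, and Q′λ₀ = Q′_{j+1}λ₀ = Q′₁ω = 0 on Λ′"*):
`λ ∈ N(Q′)` iff `Q′_jλ = 0` on `Λ^c` and `Q′₁Q′_jλ = 0` on `Λ′`. [cite: Balaban1984PropagatorsII, (2.104)–(2.105) p.241] -/
theorem inGauge_iff (lam : SiteField P 0 ℝ) :
    (twoScale j hj Λ').InGauge lam ↔
      (∀ y : Site P j, blockOf y ∉ Λ' → siteAvgIter j lam y = 0) ∧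
        ∀ Y : Site P (j + 1), Y ∈ Λ' → siteAvg (siteAvgIter j lam) Y = 0 := by
  constructor
  · intro h
    refine ⟨fun y hy => h j y ((lamSite_j y).mpr hy), fun Y hY => ?_⟩
    have := h (j + 1) Y ((lamSite_succ Y).mpr hY)
    rwa [B5Eq120IterProof.siteAvgIter_succ] at this
  · rintro ⟨h1, h2⟩ i y hy
    by_cases hij : i = j
    · subst hij
      exact h1 y ((lamSite_j y).mp hy)
    by_cases hij' : i = j + 1
    · subst hij'
      rw [B5Eq120IterProof.siteAvgIter_succ]
      exact h2 y ((lamSite_succ y).mp hy)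
    · exfalso
      rcases lt_or_gt_of_ne hij with h | h
      · exact not_lamSite_of_lt h y hy
      · exact not_lamSite_of_gt (by omega) y hy

/-- The homogeneous constraints `QA = 0` of the two-scale setting: `Q_jA = 0` on the `Λ^c`-bonds and `Q₁Q_jA = 0` on the
`Λ′`-bonds. [cite: Balaban1984PropagatorsII, (2.97) p.240] -/
theorem constr_zero_iff (A : VecField P 0 ℝ) :
    (∀ (i : ℕ) (b : PBond P i), (twoScale j hj Λ').LamBond i b → bondAvgIter i A b = 0) ↔
      (∀ b : PBond P j, blockOf b.src ∉ Λ' → blockOf b.tgt ∉ Λ' → bondAvgIter j A b = 0) ∧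
        ∀ e : PBond P (j + 1), (e.src ∈ Λ' ∨ e.tgt ∈ Λ') → bondAvg (bondAvgIter j A) e = 0 := by
  constructor
  · intro h
    refine ⟨fun b h1 h2 => h j b ((lamBond_j b).mpr ⟨h1, h2⟩), fun e he => ?_⟩
    have := h (j + 1) e ((lamBond_succ e).mpr he)
    rwa [B5Eq120IterProof.bondAvgIter_succ] at this
  · rintro ⟨h1, h2⟩ i b hb
    by_cases hij : i = j
    · subst hij
      exact h1 b ((lamBond_j b).mp hb).1 ((lamBond_j b).mp hb).2
    by_cases hij' : i = j + 1
    · subst hij'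
      rw [B5Eq120IterProof.bondAvgIter_succ]
      exact h2 b ((lamBond_succ b).mp hb)
    · exfalso
      rcases lt_or_gt_of_ne hij with h | h
      · exact not_lamBond_of_lt h b hb
      · exact not_lamBond_of_gt (by omega) b hb

end twoScale

/-! ## §2  The carriers and the operators of Sect. C on the V1 calculus -/

section Carriers

variable (P) in
/-- functions on the unit lattice `T^{(j)}` (the `ω`, `μ` of (2.101)–(2.104)) as a Euclidean space. [cite: Balaban1984PropagatorsII, (2.101) p.241] -/
abbrev USite (j : ℕ) : Type := EuclideanSpace ℝ (Site P j)

variable (P) in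
/-- vector fields on the unit lattice `T^{(j)}` (the `B = Q_jA` of (2.97)) as a Euclidean space. [cite: Balaban1984PropagatorsII, (2.97) p.240] -/
abbrev UBond (j : ℕ) : Type := EuclideanSpace ℝ (PBond P j)

/-- the `Λ^c`-bonds of the unit lattice: both end-points outside `B(Λ′)` (the `b ∈ Λ^c` of (2.97)). [cite: Balaban1984PropagatorsII, (2.97) p.240] -/
abbrev OutBond (j : ℕ) (Λ' : Finset (Site P (j + 1))) : Type := {b : PBond P j // blockOf b.src ∉ Λ' ∧ blockOf b.tgt ∉ Λ'}

/-- the `Λ′`-bonds of the `L`-lattice (the `c ∈ Λ′` of (2.97)). [cite: Balaban1984PropagatorsII, (2.97) p.240] -/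
abbrev InBond (j : ℕ) (Λ' : Finset (Site P (j + 1))) : Type := {e : PBond P (j + 1) // e.src ∈ Λ' ∨ e.tgt ∈ Λ'}

/-- `𝔅 = Λ^c ∪ Λ′` (bonds), the index set of `Q = Q″Q_j`. [cite: Balaban1984PropagatorsII, (2.97) p.240] -/
abbrev CIdx (j : ℕ) (Λ' : Finset (Site P (j + 1))) : Type := OutBond j Λ' ⊕ InBond j Λ'

/-- `L²(𝔅)`, the target of `Q″`. [cite: Balaban1984PropagatorsII, (2.119) p.243] -/
abbrev CSpace (j : ℕ) (Λ' : Finset (Site P (j + 1))) : Type := EuclideanSpace ℝ (CIdx j Λ')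

end Carriers

section Operators

variable {ι κ : Type*}

/-- components of `onE`. [folklore] -/
@[simp] private theorem onE_apply' (f : (ι → ℝ) →ₗ[ℝ] (κ → ℝ)) (x : EuclideanSpace ℝ ι) (i : κ) :
    onE f x i = f (WithLp.ofLp x) i := rfl

variable (j : ℕ)

variable (P) in
/-- `∂` on functions of `T^{(j)}` with lattice factor `c′` (the `∂₁` of (2.103), `c′ = c/L^j`), as a linear map of function spaces.
[cite: Balaban1984PropagatorsII, (2.103) p.241] -/
def gradJ (c' : ℝ) : SiteField P j ℝ →ₗ[ℝ] VecField P j ℝ where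
  toFun := grad c'
  map_add' := grad_add c'
  map_smul' a f := grad_smul c' a f

variable (P) in
/-- the block-constant lift `μ ↦ μ(x_j)` (p08's `pull j`), a right inverse of `Q′_j`, as a linear map. [cite: Balaban1984PropagatorsI, (1.15) p.19] -/
def pullJ : SiteField P j ℝ →ₗ[ℝ] SiteField P 0 ℝ where
  toFun := pull j
  map_add' f g := funext fun x => by simp [pull_apply]
  map_smul' a f := funext fun x => by simp [pull_apply]

variable (P) in
/-- **`Q′_j`** `= siteAvgIter j` on `ℓ²`. [cite: Balaban1984PropagatorsII, (2.101) p.241] -/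
def Qp : ScalarSpace P →ₗ[ℝ] USite P j := onE (siteAvgIterLin P ℝ j)

variable (P) in
/-- **`Q_j`** `= bondAvgIter j` on `ℓ²`. [cite: Balaban1984PropagatorsII, (2.95) p.240] -/
def Qv : BondSpace P →ₗ[ℝ] UBond P j := onE (bondAvgIterLin P ℝ j)

variable (P) in
/-- **`∂₁`** with lattice factor `c′`. [cite: Balaban1984PropagatorsII, (2.103) p.241] -/
def d1 (c' : ℝ) : USite P j →ₗ[ℝ] UBond P j := onE (gradJ P j c')

variable (P) in
/-- the block-constant lift on `ℓ²`. [cite: Balaban1984PropagatorsI, (1.15) p.19] -/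
def pullE : USite P j →ₗ[ℝ] ScalarSpace P := onE (pullJ P j)

/-- `(Q′_jλ)(y)`. [cite: Balaban1984PropagatorsII, (2.101) p.241] -/
@[simp] theorem Qp_apply (f : ScalarSpace P) (y : Site P j) : Qp P j f y = siteAvgIter j (WithLp.ofLp f) y := rfl

/-- `Q′_jλ` as a function. [cite: Balaban1984PropagatorsII, (2.101) p.241] -/
theorem ofLp_Qp (f : ScalarSpace P) : WithLp.ofLp (Qp P j f) = siteAvgIter j (WithLp.ofLp f) := rfl

/-- `(Q_jA)(b)`. [cite: Balaban1984PropagatorsII, (2.95) p.240] -/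
@[simp] theorem Qv_apply (x : BondSpace P) (b : PBond P j) : Qv P j x b = bondAvgIter j (WithLp.ofLp x) b := rfl

/-- `Q_jA` as a function. [cite: Balaban1984PropagatorsII, (2.95) p.240] -/
theorem ofLp_Qv (x : BondSpace P) : WithLp.ofLp (Qv P j x) = bondAvgIter j (WithLp.ofLp x) := rfl

/-- `(∂₁ω)(b) = c′(ω(b₊) − ω(b₋))`. [cite: Balaban1984PropagatorsII, (2.103) p.241] -/
@[simp] theorem d1_apply (c' : ℝ) (ω : USite P j) (b : PBond P j) : d1 P j c' ω b = grad c' (WithLp.ofLp ω) b := rfl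

/-- `∂₁ω` as a function. [cite: Balaban1984PropagatorsII, (2.103) p.241] -/
theorem ofLp_d1 (c' : ℝ) (ω : USite P j) : WithLp.ofLp (d1 P j c' ω) = grad c' (WithLp.ofLp ω) := rfl

/-- the lift as a function. [cite: Balaban1984PropagatorsI, (1.15) p.19] -/
theorem ofLp_pullE (ω : USite P j) : WithLp.ofLp (pullE P j ω) = pull j (WithLp.ofLp ω) := rfl

/-- `Q′_j` of the block-constant lift is the identity (standing range). [cite: Balaban1984PropagatorsI, (1.15) p.19] -/
theorem Qp_pullE (hj : j ≤ P.m + P.K) (ω : USite P j) : Qp P j (pullE P j ω) = ω := by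
  apply PiLp.ext; intro y
  rw [Qp_apply, ofLp_pullE, siteAvgIter_pull j hj]

variable (Λ' : Finset (Site P (j + 1)))

variable (P) in
/-- **The admissible `ω`** of (2.95)–(2.97)/(2.104): *"configurations ω … defined on Λ"* (`ω = 0` on `Λ^c`) with
`δ(Q′₁ω)` on `Λ′` (*"μ = 0 on Λ^c, Q′₁μ = 0 on Λ′ (2.104)"*). [cite: Balaban1984PropagatorsII, (2.104) p.241] -/
def admissible : Submodule ℝ (USite P j) where
  carrier := {ω | (∀ y : Site P j, blockOf y ∉ Λ' → ω y = 0) ∧ ∀ Y : Site P (j + 1), Y ∈ Λ' → siteAvg (WithLp.ofLp ω) Y = 0}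
  zero_mem' := ⟨fun y _ => rfl, fun Y _ => by
    rw [WithLp.ofLp_zero, B5AveragingLocalityV1.siteAvg_zero]; rfl⟩
  add_mem' {a b} ha hb := ⟨fun y hy => by rw [PiLp.add_apply, ha.1 y hy, hb.1 y hy, add_zero], fun Y hY => by
    rw [WithLp.ofLp_add, siteAvg_add, Pi.add_apply, ha.2 Y hY, hb.2 Y hY, add_zero]⟩
  smul_mem' r a ha := ⟨fun y hy => by rw [PiLp.smul_apply, ha.1 y hy, smul_zero], fun Y hY => by
    rw [WithLp.ofLp_smul, siteAvg_smul, Pi.smul_apply, ha.2 Y hY, smul_zero]⟩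

/-- membership in `admissible`. [cite: Balaban1984PropagatorsII, (2.104) p.241] -/
theorem mem_admissible (ω : USite P j) : ω ∈ admissible P j Λ' ↔
    (∀ y : Site P j, blockOf y ∉ Λ' → ω y = 0) ∧ ∀ Y : Site P (j + 1), Y ∈ Λ' → siteAvg (WithLp.ofLp ω) Y = 0 := Iff.rfl

/-- For an admissible `ω`, `Q′₁ω = 0` EVERYWHERE (on `Λ′` by definition, off `Λ′` because `ω` vanishes on the block; standing
range). [cite: Balaban1984PropagatorsII, (2.104) p.241] -/
theorem siteAvg_admissible (hj : j + 1 ≤ P.m + P.K) {ω : USite P j} (hω : ω ∈ admissible P j Λ') (Y : Site P (j + 1)) :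
    siteAvg (WithLp.ofLp ω) Y = 0 := by
  by_cases hY : Y ∈ Λ'
  · exact hω.2 Y hY
  · exact B5AveragingLocalityV1.siteAvg_eq_zero_of_local hj _ Y fun z hz => hω.1 z (by rwa [hz])

variable (P) in
/-- **The block axial gauge on `Λ′`**: `Π_{y∈Λ′}δ_{Ax(y)}(B)`, `B(Γ_{y,x}) = 0` for `x ∈ B(y)`, `y ∈ Λ′` ([4] (1.10); r18's staircase
sums `stairSum`, centred blocks). [cite: Balaban1984PropagatorsII, (2.95)–(2.97) p.240] -/
def axial : Submodule ℝ (UBond P j) where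
  carrier := {B | ∀ Y : Site P (j + 1), Y ∈ Λ' → ∀ r : Fin P.d → Fin P.L,
    stairSum (WithLp.ofLp B) (emb Y) (Site.blockSite Y r) = 0}
  zero_mem' Y _ r := by
    have h := stairSum_smul (P := P) (j := j) (V := ℝ) 0 0 (emb Y) (Site.blockSite Y r)
    rw [zero_smul, zero_smul] at h
    rw [WithLp.ofLp_zero]; exact h
  add_mem' {a b} ha hb Y hY r := by rw [WithLp.ofLp_add, stairSum_add, ha Y hY r, hb Y hY r, add_zero]
  smul_mem' t a ha Y hY r := by rw [WithLp.ofLp_smul, stairSum_smul, ha Y hY r, smul_zero]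

/-- membership in `axial`. [cite: Balaban1984PropagatorsII, (2.97) p.240] -/
theorem mem_axial (B : UBond P j) : B ∈ axial P j Λ' ↔ ∀ Y : Site P (j + 1), Y ∈ Λ' → ∀ r : Fin P.d → Fin P.L,
    stairSum (WithLp.ofLp B) (emb Y) (Site.blockSite Y r) = 0 := Iff.rfl

variable (P) in
/-- `Q″` on functions: `B ↦ (B↾Λ^c, (Q₁B)↾Λ′)` ((2.97): the `Q_jA` terms on `Λ^c` and the `Q_{j+1}A = Q₁Q_jA` terms on `Λ′`).
[cite: Balaban1984PropagatorsII, (2.97) p.240 + (2.119) p.243] -/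
def qppFn : VecField P j ℝ →ₗ[ℝ] (CIdx j Λ' → ℝ) where
  toFun B := Sum.elim (fun b => B b.1) (fun e => bondAvg B e.1)
  map_add' A B := funext fun i => by rcases i with b | e <;> simp [bondAvg_add]
  map_smul' t A := funext fun i => by rcases i with b | e <;> simp [bondAvg_smul]

variable (P) in
/-- **`Q″`** with `Q = Q″Q_j` (2.119). [cite: Balaban1984PropagatorsII, (2.119) p.243] -/
def Qpp : UBond P j →ₗ[ℝ] CSpace j Λ' := onE (qppFn P j Λ')

/-- `(Q″B)(b) = B(b)` on a `Λ^c`-bond. [cite: Balaban1984PropagatorsII, (2.97) p.240] -/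
@[simp] theorem Qpp_inl (B : UBond P j) (b : OutBond j Λ') : Qpp P j Λ' B (Sum.inl b) = B b.1 := rfl

/-- `(Q″B)(c) = (Q₁B)(c)` on a `Λ′`-bond. [cite: Balaban1984PropagatorsII, (2.97) p.240] -/
@[simp] theorem Qpp_inr (B : UBond P j) (e : InBond j Λ') : Qpp P j Λ' B (Sum.inr e) = bondAvg (WithLp.ofLp B) e.1 := rfl

variable (P) in
/-- the weight `a` on `L²(𝔅)` (printed: `a` on `Λ^c`, `aL^{d−2}` on `Λ′`, (2.97)). [cite: Balaban1984PropagatorsII, (2.97) p.240] -/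
def aW (w : CIdx j Λ' → ℝ) : CSpace j Λ' →ₗ[ℝ] CSpace j Λ' := onE (diagFn w)

/-- `(aφ)(i) = w(i)φ(i)`. [cite: Balaban1984PropagatorsII, (2.97) p.240] -/
@[simp] theorem aW_apply (w : CIdx j Λ' → ℝ) (φ : CSpace j Λ') (i : CIdx j Λ') : aW P j Λ' w φ i = w i * φ i := rfl

variable (P) in
/-- the PRINTED weights of (2.97): `a` on the `Λ^c`-bonds, `aL^{d−2}` on the `Λ′`-bonds. [cite: Balaban1984PropagatorsII, (2.97) p.240] -/
def wPrinted (a : ℝ) : CIdx j Λ' → ℝ := Sum.elim (fun _ => a) (fun _ => a * (P.L : ℝ) ^ (P.d - 2))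

/-- the printed weights are positive for `a > 0`. [cite: Balaban1984PropagatorsII, (2.97) p.240] -/
theorem wPrinted_pos {a : ℝ} (ha : 0 < a) (i : CIdx j Λ') : 0 < wPrinted P j Λ' a i := by
  rcases i with b | e
  · exact ha
  · exact mul_pos ha (pow_pos (Nat.cast_pos.mpr P.L_pos) _)

end Operators

end Literature.MathematicalPhysics.QuantumFieldTheory.Balaban1983to89.B6SectCTwoScaleV1

end
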